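import Summits.BirchSwinnertonDyer.BirchSwinnertonDyer.Theorems.Rank2ObservatoryRank3PSatCertK
import Summits.BirchSwinnertonDyer.BirchSwinnertonDyer.Theorems.Rank2ObservatoryRank3Rows14
import Summits.BirchSwinnertonDyer.BirchSwinnertonDyer.Theorems.Rank2ObservatoryRank3Rows15
import Summits.BirchSwinnertonDyer.BirchSwinnertonDyer.Theorems.Rank2ObservatoryRank3Rows16
import Summits.BirchSwinnertonDyer.BirchSwinnertonDyer.Theorems.Rank2ObservatoryRank3Rows17
import Summits.BirchSwinnertonDyer.BirchSwinnertonDyer.Theorems.Rank2ObservatoryRank3Rows18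
import Summits.BirchSwinnertonDyer.BirchSwinnertonDyer.Theorems.Rank2ObservatoryRank3Rows19
import Summits.BirchSwinnertonDyer.BirchSwinnertonDyer.Theorems.Rank2ObservatoryRank3PSat357Census
import Summits.BirchSwinnertonDyer.BirchSwinnertonDyer.Theorems.Rank2ObservatoryRank3PSatM31JoinA
import HarnessLib

/-!
# BirchSwinnertonDyer — rank ≥ 2 observatory: S10-CPS census (J11c), chunks 14–19: GENERATORS

HONEST FRAMING: per-curve certified theorems and census instruments; no claim on BSD in rank ≥ 2.

THE CPS-BOUND SEARCH CENSUS, chunks 14–19 (92 rows of these chunks; 396 of the 9 487 GRAND rank-3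
rows in all — rows of the residual 396 of the generators union census
`GeneratorsCensus.census_total`, i.e. rows whose Silverman-constant search bound exceeded every
earlier register). Register J11c replaces Silverman's height-difference constant by the
Cremona–Prickett–Siksek bound [CremonaPrickettSiksek2006, Thm 1 with Table 1 and Lemmas 9–10: on the
global minimal model, `h(P) − ĥ(P) ≤ (1/3) log ε_∞ + Σ_p α_p log p`, `h(P) = log max(|num x|, den
x)`, `ĥ` in the PARI / BSD normalisation `lim h(2ⁿP)/4ⁿ`] computed by TWO implementations that AGREE
on every listed row (identical (p, Kodaira symbol, c_p) at every bad prime and |B_A − B_B| ≤ 10⁻⁶;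
the register uses max(B_A, B_B) + 0.01): implementation A = PARI `elllocalred` + `polrootsreal`
(kit), cell implementation B = exact rational Sturm arithmetic for the real place + a PARI-free Tate
algorithm (validated against the paper's Examples 3–4 to 10⁻⁹). Both implementations then enumerate
ALL points of naive height `max(|num x|, den x) ≤ H` (A: PARI `ellratpoints` + `ellorder` +
`ellheight`; B: the engine of record `ecpointsieve` 0.1.0, engines MANIFEST 0c2f6b8785a885b8, exact
torsion and exact-doubling height brackets) and AGREE (point count, non-torsion count, A's minimal
height inside B's bracket, the listed generators found). The datum `m` is: LEVER H — Hermite (`γ₃³ =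
2`) with `λ₁ ≥ min(log(H+1) − B, min ĥ found)`, `index ≤ m = ⌊√(2·Reg_hi/λ₁³)⌋ ≤ 10`, the larger of
the two implementations' values; LEVER S (rows whose `λ₁` is fixed by an actual small point,
recorded with `m = 1`) — saturation by exhaustive search [Siksek, Rocky Mountain J. Math. 25 (1995);
CremonaAlgorithms1997 §3.5]: with `Λ* = ¼·max_± ĥ(P₁ ± P₂ ± P₃)` and `log(H+1) > Λ* + B`, every
point of `E(ℚ)` with `ĥ ≤ Λ*` is enumerated, and BOTH implementations decide EXACTLY (integer
coefficients, exact group law, exact torsion test) that each of them lies in `ℤP₁ + ℤP₂ + ℤP₃ +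
E(ℚ)_tors`; since a proper finite-index sublattice of full rank leaves a coset representative of
height `≤ Λ*` outside, the index is 1 (the rank `= 3` of the row is the recorded rank,
kernel-certified for the rows of `Rank3KernelRankCensusN9375`). As in the landed S10 files the
number `m` is instrument DATA: it enters ONLY as the hypothesis `index ≤ m` of `generatorsNN` and as
the (EMPTY: no prime `7 < p ≤ m ≤ 10`) range of the saturation certificate list, checked by the
landed selection Boolean `rank3PSatCheckKSel` by kernel `decide` (`pSatCheckK_NN`), exported by the
landed soundness theorem `Rank3Row.pSaturated_of_pSatCheckKSel_idx` (`coverNN`), and JOINED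
(`generatorsNN`) with the KS3 census `PSatCensus357.index_coprime_210_of_mem_rows` exactly as in
`PSatCensusS10`: under the ONE named numeric hypothesis `index ≤ m` the listed points and the
torsion GENERATE. No definitions; no new lemmas. Register (instrument data, kit job j342025, tag
bsd-r1): cell `code/b2b-bsdr2-cert-2/sat2-r3/g46/j11c/prod-j342025/` — `register-J11c.tsv` sha256
d829e0e83d7ddbf6…, `j11c.jsonl` sha256 82254102cac8b632…, SHA256SUMS, README-J11c.md (method, the
LEVER S argument, referee spot-check kit).

References: Cremona–Prickett–Siksek, J. Number Theory 116 (2006) 42–68, Thm 1, Table 1, Lemmas 9–10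
[CremonaPrickettSiksek2006]; Siksek, Rocky Mountain J. Math. 25 (1995) 1501–1538, §3; Cremona,
*Algorithms for Modular Elliptic Curves* (1997) §3.5 [CremonaAlgorithms1997]; Silverman,
*The Arithmetic of Elliptic Curves* (2009) VIII.6.7.
-/

-- single-conjunct summit: `Summit.BirchSwinnertonDyer.BirchSwinnertonDyer.…` repeats the name
set_option linter.dupNamespace false

namespace Summit.BirchSwinnertonDyer.BirchSwinnertonDyer.Rank2Observatory

namespace PSatCensusS10CPS

open Rank3KernelRankCensusN9365 (rows mem_rank3Table rank_eq_three)
open PSatCensusM31 (eq_one_of_forall_prime_le_not_dvd not_dvd_of_prime_le_seven)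

/-- **Chunk 14, register J11c** (9 rows, two-implementation CPS-bound datum `m ≤ 10`): kernel check
of the selection `(position, m, [])` — every listed row exists in `rank3Rows14` and no prime
`7 < p ≤ m` is left uncertified (there is none). [cite: CremonaPrickettSiksek2006, Thm 1] -/
theorem pSatCheckK_14 :
    rank3PSatCheckKSel rank3Rows14 [
    (15, 3, []), (59, 5, []), (256, 4, []), (276, 2, []), (294, 1, []), (297, 1, []), (309, 5, []),
    (310, 2, []), (319, 2, [])] = true := by
  decide +kernel

set_option maxRecDepth 8000 in
/-- **Chunk 14: cover** — for every listed `(i, m)` the row `rank3Rows14[i]` exists and its listed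
span is `p`-saturated for every prime `7 < p ≤ m` (vacuous range; generic soundness of the selection
form). [cite: CremonaAlgorithms1997, §3.5] -/
theorem cover14 :
    ∀ e ∈ ([
      (15, 3), (59, 5), (256, 4), (276, 2), (294, 1), (297, 1), (309, 5), (310, 2), (319,
      2)] : List (ℕ × ℕ)),
      ∃ r, rank3Rows14[e.1]? = some r ∧ ∀ p, p.Prime → 7 < p → p ≤ e.2 →
        ∀ h : r.check = true, ∀ a : r.curve.toAffine.Point,
          p • a ∈ AddSubgroup.closure {r.gen₁ h, r.gen₂ h, r.gen₃ h} ⊔ AddCommGroup.torsion _ →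
            a ∈ AddSubgroup.closure {r.gen₁ h, r.gen₂ h, r.gen₃ h} ⊔ AddCommGroup.torsion _ :=
  Rank3Row.pSaturated_of_pSatCheckKSel_idx (by rfl) pSatCheckK_14

/-- **GENERATORS under ONE named numeric hypothesis, chunk 14** (9 rows, register J11c
`m ≤ 10`; `m = 1` rows = LEVER S, saturation by exhaustive search): for every listed `(i, m)`, if
`rank3Rows14[i]` is a GRAND row and the index of its listed span is `≤ m` (instrument DATA, two
implementations agree), then `E(ℚ) = ℤP₁ + ℤP₂ + ℤP₃ + E(ℚ)_tors`.
[cite: CremonaPrickettSiksek2006, Thm 1] [cite: CremonaAlgorithms1997, §3.5] -/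
theorem generators14 :
    ∀ e ∈ ([
      (15, 3), (59, 5), (256, 4), (276, 2), (294, 1), (297, 1), (309, 5), (310, 2), (319,
      2)] : List (ℕ × ℕ)),
      ∃ r, rank3Rows14[e.1]? = some r ∧ ∀ (hr : r ∈ rows) (h : r.check = true),
        (AddSubgroup.closure {r.gen₁ h, r.gen₂ h, r.gen₃ h} ⊔ AddCommGroup.torsion _).index ≤ e.2 →
          AddSubgroup.closure {r.gen₁ h, r.gen₂ h, r.gen₃ h} ⊔ AddCommGroup.torsion _ = ⊤ := by
  intro e he
  obtain ⟨r, hr', H⟩ := cover14 e he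
  refine ⟨r, hr', fun hr h hB => ?_⟩
  obtain ⟨hfi, h2, h3, h5, h7⟩ := PSatCensus357.index_coprime_210_of_mem_rows hr h
  haveI := hfi
  refine AddSubgroup.index_eq_one.mp
    (eq_one_of_forall_prime_le_not_dvd AddSubgroup.FiniteIndex.index_ne_zero hB fun p hp hpB => ?_)
  by_cases h7p : 7 < p
  · exact not_dvd_index_listedSpan hp (H p hp h7p hpB h)
  · exact not_dvd_of_prime_le_seven h2 h3 h5 h7 hp h7p

/-- **Chunk 15, register J11c** (24 rows, two-implementation CPS-bound datum `m ≤ 10`): kernel check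
of the selection `(position, m, [])` — every listed row exists in `rank3Rows15` and no prime
`7 < p ≤ m` is left uncertified (there is none). [cite: CremonaPrickettSiksek2006, Thm 1] -/
theorem pSatCheckK_15 :
    rank3PSatCheckKSel rank3Rows15 [
    (27, 1, []), (30, 1, []), (37, 2, []), (40, 1, []), (68, 1, []), (80, 3, []), (109, 4, []),
    (157, 1, []), (158, 2, []), (163, 1, []), (183, 9, []), (194, 3, []), (262, 2, []),
    (263, 1, []), (285, 1, []), (303, 1, []), (304, 1, []), (308, 1, []), (309, 3, []),
    (311, 1, []), (330, 2, []), (337, 1, []), (342, 2, []), (346, 1, [])] = true := by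
  decide +kernel

set_option maxRecDepth 8000 in
/-- **Chunk 15: cover** — for every listed `(i, m)` the row `rank3Rows15[i]` exists and its listed
span is `p`-saturated for every prime `7 < p ≤ m` (vacuous range; generic soundness of the selection
form). [cite: CremonaAlgorithms1997, §3.5] -/
theorem cover15 :
    ∀ e ∈ ([
      (27, 1), (30, 1), (37, 2), (40, 1), (68, 1), (80, 3), (109, 4), (157, 1), (158, 2), (163, 1),
      (183, 9), (194, 3), (262, 2), (263, 1), (285, 1), (303, 1), (304, 1), (308, 1), (309, 3),
      (311, 1), (330, 2), (337, 1), (342, 2), (346, 1)] : List (ℕ × ℕ)),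
      ∃ r, rank3Rows15[e.1]? = some r ∧ ∀ p, p.Prime → 7 < p → p ≤ e.2 →
        ∀ h : r.check = true, ∀ a : r.curve.toAffine.Point,
          p • a ∈ AddSubgroup.closure {r.gen₁ h, r.gen₂ h, r.gen₃ h} ⊔ AddCommGroup.torsion _ →
            a ∈ AddSubgroup.closure {r.gen₁ h, r.gen₂ h, r.gen₃ h} ⊔ AddCommGroup.torsion _ :=
  Rank3Row.pSaturated_of_pSatCheckKSel_idx (by rfl) pSatCheckK_15

/-- **GENERATORS under ONE named numeric hypothesis, chunk 15** (24 rows, register J11c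
`m ≤ 10`; `m = 1` rows = LEVER S, saturation by exhaustive search): for every listed `(i, m)`, if
`rank3Rows15[i]` is a GRAND row and the index of its listed span is `≤ m` (instrument DATA, two
implementations agree), then `E(ℚ) = ℤP₁ + ℤP₂ + ℤP₃ + E(ℚ)_tors`.
[cite: CremonaPrickettSiksek2006, Thm 1] [cite: CremonaAlgorithms1997, §3.5] -/
theorem generators15 :
    ∀ e ∈ ([
      (27, 1), (30, 1), (37, 2), (40, 1), (68, 1), (80, 3), (109, 4), (157, 1), (158, 2), (163, 1),
      (183, 9), (194, 3), (262, 2), (263, 1), (285, 1), (303, 1), (304, 1), (308, 1), (309, 3),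
      (311, 1), (330, 2), (337, 1), (342, 2), (346, 1)] : List (ℕ × ℕ)),
      ∃ r, rank3Rows15[e.1]? = some r ∧ ∀ (hr : r ∈ rows) (h : r.check = true),
        (AddSubgroup.closure {r.gen₁ h, r.gen₂ h, r.gen₃ h} ⊔ AddCommGroup.torsion _).index ≤ e.2 →
          AddSubgroup.closure {r.gen₁ h, r.gen₂ h, r.gen₃ h} ⊔ AddCommGroup.torsion _ = ⊤ := by
  intro e he
  obtain ⟨r, hr', H⟩ := cover15 e he
  refine ⟨r, hr', fun hr h hB => ?_⟩
  obtain ⟨hfi, h2, h3, h5, h7⟩ := PSatCensus357.index_coprime_210_of_mem_rows hr h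
  haveI := hfi
  refine AddSubgroup.index_eq_one.mp
    (eq_one_of_forall_prime_le_not_dvd AddSubgroup.FiniteIndex.index_ne_zero hB fun p hp hpB => ?_)
  by_cases h7p : 7 < p
  · exact not_dvd_index_listedSpan hp (H p hp h7p hpB h)
  · exact not_dvd_of_prime_le_seven h2 h3 h5 h7 hp h7p

/-- **Chunk 16, register J11c** (11 rows, two-implementation CPS-bound datum `m ≤ 10`): kernel check
of the selection `(position, m, [])` — every listed row exists in `rank3Rows16` and no prime
`7 < p ≤ m` is left uncertified (there is none). [cite: CremonaPrickettSiksek2006, Thm 1] -/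
theorem pSatCheckK_16 :
    rank3PSatCheckKSel rank3Rows16 [
    (4, 2, []), (13, 3, []), (14, 6, []), (68, 3, []), (72, 5, []), (89, 1, []), (112, 1, []),
    (113, 1, []), (121, 1, []), (134, 7, []), (314, 1, [])] = true := by
  decide +kernel

set_option maxRecDepth 8000 in
/-- **Chunk 16: cover** — for every listed `(i, m)` the row `rank3Rows16[i]` exists and its listed
span is `p`-saturated for every prime `7 < p ≤ m` (vacuous range; generic soundness of the selection
form). [cite: CremonaAlgorithms1997, §3.5] -/
theorem cover16 :
    ∀ e ∈ ([
      (4, 2), (13, 3), (14, 6), (68, 3), (72, 5), (89, 1), (112, 1), (113, 1), (121, 1), (134, 7),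
      (314, 1)] : List (ℕ × ℕ)),
      ∃ r, rank3Rows16[e.1]? = some r ∧ ∀ p, p.Prime → 7 < p → p ≤ e.2 →
        ∀ h : r.check = true, ∀ a : r.curve.toAffine.Point,
          p • a ∈ AddSubgroup.closure {r.gen₁ h, r.gen₂ h, r.gen₃ h} ⊔ AddCommGroup.torsion _ →
            a ∈ AddSubgroup.closure {r.gen₁ h, r.gen₂ h, r.gen₃ h} ⊔ AddCommGroup.torsion _ :=
  Rank3Row.pSaturated_of_pSatCheckKSel_idx (by rfl) pSatCheckK_16

/-- **GENERATORS under ONE named numeric hypothesis, chunk 16** (11 rows, register J11c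
`m ≤ 10`; `m = 1` rows = LEVER S, saturation by exhaustive search): for every listed `(i, m)`, if
`rank3Rows16[i]` is a GRAND row and the index of its listed span is `≤ m` (instrument DATA, two
implementations agree), then `E(ℚ) = ℤP₁ + ℤP₂ + ℤP₃ + E(ℚ)_tors`.
[cite: CremonaPrickettSiksek2006, Thm 1] [cite: CremonaAlgorithms1997, §3.5] -/
theorem generators16 :
    ∀ e ∈ ([
      (4, 2), (13, 3), (14, 6), (68, 3), (72, 5), (89, 1), (112, 1), (113, 1), (121, 1), (134, 7),
      (314, 1)] : List (ℕ × ℕ)),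
      ∃ r, rank3Rows16[e.1]? = some r ∧ ∀ (hr : r ∈ rows) (h : r.check = true),
        (AddSubgroup.closure {r.gen₁ h, r.gen₂ h, r.gen₃ h} ⊔ AddCommGroup.torsion _).index ≤ e.2 →
          AddSubgroup.closure {r.gen₁ h, r.gen₂ h, r.gen₃ h} ⊔ AddCommGroup.torsion _ = ⊤ := by
  intro e he
  obtain ⟨r, hr', H⟩ := cover16 e he
  refine ⟨r, hr', fun hr h hB => ?_⟩
  obtain ⟨hfi, h2, h3, h5, h7⟩ := PSatCensus357.index_coprime_210_of_mem_rows hr h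
  haveI := hfi
  refine AddSubgroup.index_eq_one.mp
    (eq_one_of_forall_prime_le_not_dvd AddSubgroup.FiniteIndex.index_ne_zero hB fun p hp hpB => ?_)
  by_cases h7p : 7 < p
  · exact not_dvd_index_listedSpan hp (H p hp h7p hpB h)
  · exact not_dvd_of_prime_le_seven h2 h3 h5 h7 hp h7p

/-- **Chunk 17, register J11c** (13 rows, two-implementation CPS-bound datum `m ≤ 10`): kernel check
of the selection `(position, m, [])` — every listed row exists in `rank3Rows17` and no prime
`7 < p ≤ m` is left uncertified (there is none). [cite: CremonaPrickettSiksek2006, Thm 1] -/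
theorem pSatCheckK_17 :
    rank3PSatCheckKSel rank3Rows17 [
    (3, 3, []), (64, 1, []), (75, 1, []), (84, 1, []), (86, 1, []), (90, 2, []), (118, 2, []),
    (152, 7, []), (157, 1, []), (171, 2, []), (180, 10, []), (182, 1, []), (280, 3,
    [])] = true := by
  decide +kernel

set_option maxRecDepth 8000 in
/-- **Chunk 17: cover** — for every listed `(i, m)` the row `rank3Rows17[i]` exists and its listed
span is `p`-saturated for every prime `7 < p ≤ m` (vacuous range; generic soundness of the selection
form). [cite: CremonaAlgorithms1997, §3.5] -/
theorem cover17 :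
    ∀ e ∈ ([
      (3, 3), (64, 1), (75, 1), (84, 1), (86, 1), (90, 2), (118, 2), (152, 7), (157, 1), (171, 2),
      (180, 10), (182, 1), (280, 3)] : List (ℕ × ℕ)),
      ∃ r, rank3Rows17[e.1]? = some r ∧ ∀ p, p.Prime → 7 < p → p ≤ e.2 →
        ∀ h : r.check = true, ∀ a : r.curve.toAffine.Point,
          p • a ∈ AddSubgroup.closure {r.gen₁ h, r.gen₂ h, r.gen₃ h} ⊔ AddCommGroup.torsion _ →
            a ∈ AddSubgroup.closure {r.gen₁ h, r.gen₂ h, r.gen₃ h} ⊔ AddCommGroup.torsion _ :=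
  Rank3Row.pSaturated_of_pSatCheckKSel_idx (by rfl) pSatCheckK_17

/-- **GENERATORS under ONE named numeric hypothesis, chunk 17** (13 rows, register J11c
`m ≤ 10`; `m = 1` rows = LEVER S, saturation by exhaustive search): for every listed `(i, m)`, if
`rank3Rows17[i]` is a GRAND row and the index of its listed span is `≤ m` (instrument DATA, two
implementations agree), then `E(ℚ) = ℤP₁ + ℤP₂ + ℤP₃ + E(ℚ)_tors`.
[cite: CremonaPrickettSiksek2006, Thm 1] [cite: CremonaAlgorithms1997, §3.5] -/
theorem generators17 :
    ∀ e ∈ ([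
      (3, 3), (64, 1), (75, 1), (84, 1), (86, 1), (90, 2), (118, 2), (152, 7), (157, 1), (171, 2),
      (180, 10), (182, 1), (280, 3)] : List (ℕ × ℕ)),
      ∃ r, rank3Rows17[e.1]? = some r ∧ ∀ (hr : r ∈ rows) (h : r.check = true),
        (AddSubgroup.closure {r.gen₁ h, r.gen₂ h, r.gen₃ h} ⊔ AddCommGroup.torsion _).index ≤ e.2 →
          AddSubgroup.closure {r.gen₁ h, r.gen₂ h, r.gen₃ h} ⊔ AddCommGroup.torsion _ = ⊤ := by
  intro e he
  obtain ⟨r, hr', H⟩ := cover17 e he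
  refine ⟨r, hr', fun hr h hB => ?_⟩
  obtain ⟨hfi, h2, h3, h5, h7⟩ := PSatCensus357.index_coprime_210_of_mem_rows hr h
  haveI := hfi
  refine AddSubgroup.index_eq_one.mp
    (eq_one_of_forall_prime_le_not_dvd AddSubgroup.FiniteIndex.index_ne_zero hB fun p hp hpB => ?_)
  by_cases h7p : 7 < p
  · exact not_dvd_index_listedSpan hp (H p hp h7p hpB h)
  · exact not_dvd_of_prime_le_seven h2 h3 h5 h7 hp h7p

/-- **Chunk 18, register J11c** (19 rows, two-implementation CPS-bound datum `m ≤ 10`): kernel check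
of the selection `(position, m, [])` — every listed row exists in `rank3Rows18` and no prime
`7 < p ≤ m` is left uncertified (there is none). [cite: CremonaPrickettSiksek2006, Thm 1] -/
theorem pSatCheckK_18 :
    rank3PSatCheckKSel rank3Rows18 [
    (0, 2, []), (4, 5, []), (8, 5, []), (17, 3, []), (25, 1, []), (38, 1, []), (44, 1, []),
    (51, 3, []), (61, 1, []), (153, 2, []), (154, 6, []), (160, 4, []), (177, 2, []), (243, 2, []),
    (263, 1, []), (264, 2, []), (273, 4, []), (332, 1, []), (346, 1, [])] = true := by
  decide +kernel

set_option maxRecDepth 8000 in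
/-- **Chunk 18: cover** — for every listed `(i, m)` the row `rank3Rows18[i]` exists and its listed
span is `p`-saturated for every prime `7 < p ≤ m` (vacuous range; generic soundness of the selection
form). [cite: CremonaAlgorithms1997, §3.5] -/
theorem cover18 :
    ∀ e ∈ ([
      (0, 2), (4, 5), (8, 5), (17, 3), (25, 1), (38, 1), (44, 1), (51, 3), (61, 1), (153, 2),
      (154, 6), (160, 4), (177, 2), (243, 2), (263, 1), (264, 2), (273, 4), (332, 1), (346,
      1)] : List (ℕ × ℕ)),
      ∃ r, rank3Rows18[e.1]? = some r ∧ ∀ p, p.Prime → 7 < p → p ≤ e.2 →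
        ∀ h : r.check = true, ∀ a : r.curve.toAffine.Point,
          p • a ∈ AddSubgroup.closure {r.gen₁ h, r.gen₂ h, r.gen₃ h} ⊔ AddCommGroup.torsion _ →
            a ∈ AddSubgroup.closure {r.gen₁ h, r.gen₂ h, r.gen₃ h} ⊔ AddCommGroup.torsion _ :=
  Rank3Row.pSaturated_of_pSatCheckKSel_idx (by rfl) pSatCheckK_18

/-- **GENERATORS under ONE named numeric hypothesis, chunk 18** (19 rows, register J11c
`m ≤ 10`; `m = 1` rows = LEVER S, saturation by exhaustive search): for every listed `(i, m)`, if
`rank3Rows18[i]` is a GRAND row and the index of its listed span is `≤ m` (instrument DATA, two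
implementations agree), then `E(ℚ) = ℤP₁ + ℤP₂ + ℤP₃ + E(ℚ)_tors`.
[cite: CremonaPrickettSiksek2006, Thm 1] [cite: CremonaAlgorithms1997, §3.5] -/
theorem generators18 :
    ∀ e ∈ ([
      (0, 2), (4, 5), (8, 5), (17, 3), (25, 1), (38, 1), (44, 1), (51, 3), (61, 1), (153, 2),
      (154, 6), (160, 4), (177, 2), (243, 2), (263, 1), (264, 2), (273, 4), (332, 1), (346,
      1)] : List (ℕ × ℕ)),
      ∃ r, rank3Rows18[e.1]? = some r ∧ ∀ (hr : r ∈ rows) (h : r.check = true),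
        (AddSubgroup.closure {r.gen₁ h, r.gen₂ h, r.gen₃ h} ⊔ AddCommGroup.torsion _).index ≤ e.2 →
          AddSubgroup.closure {r.gen₁ h, r.gen₂ h, r.gen₃ h} ⊔ AddCommGroup.torsion _ = ⊤ := by
  intro e he
  obtain ⟨r, hr', H⟩ := cover18 e he
  refine ⟨r, hr', fun hr h hB => ?_⟩
  obtain ⟨hfi, h2, h3, h5, h7⟩ := PSatCensus357.index_coprime_210_of_mem_rows hr h
  haveI := hfi
  refine AddSubgroup.index_eq_one.mp
    (eq_one_of_forall_prime_le_not_dvd AddSubgroup.FiniteIndex.index_ne_zero hB fun p hp hpB => ?_)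
  by_cases h7p : 7 < p
  · exact not_dvd_index_listedSpan hp (H p hp h7p hpB h)
  · exact not_dvd_of_prime_le_seven h2 h3 h5 h7 hp h7p

/-- **Chunk 19, register J11c** (16 rows, two-implementation CPS-bound datum `m ≤ 10`): kernel check
of the selection `(position, m, [])` — every listed row exists in `rank3Rows19` and no prime
`7 < p ≤ m` is left uncertified (there is none). [cite: CremonaPrickettSiksek2006, Thm 1] -/
theorem pSatCheckK_19 :
    rank3PSatCheckKSel rank3Rows19 [
    (21, 2, []), (27, 4, []), (28, 2, []), (61, 1, []), (68, 1, []), (82, 1, []), (86, 4, []),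
    (138, 1, []), (160, 4, []), (178, 1, []), (209, 2, []), (210, 2, []), (260, 1, []),
    (273, 1, []), (318, 1, []), (347, 1, [])] = true := by
  decide +kernel

set_option maxRecDepth 8000 in
/-- **Chunk 19: cover** — for every listed `(i, m)` the row `rank3Rows19[i]` exists and its listed
span is `p`-saturated for every prime `7 < p ≤ m` (vacuous range; generic soundness of the selection
form). [cite: CremonaAlgorithms1997, §3.5] -/
theorem cover19 :
    ∀ e ∈ ([
      (21, 2), (27, 4), (28, 2), (61, 1), (68, 1), (82, 1), (86, 4), (138, 1), (160, 4), (178, 1),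
      (209, 2), (210, 2), (260, 1), (273, 1), (318, 1), (347, 1)] : List (ℕ × ℕ)),
      ∃ r, rank3Rows19[e.1]? = some r ∧ ∀ p, p.Prime → 7 < p → p ≤ e.2 →
        ∀ h : r.check = true, ∀ a : r.curve.toAffine.Point,
          p • a ∈ AddSubgroup.closure {r.gen₁ h, r.gen₂ h, r.gen₃ h} ⊔ AddCommGroup.torsion _ →
            a ∈ AddSubgroup.closure {r.gen₁ h, r.gen₂ h, r.gen₃ h} ⊔ AddCommGroup.torsion _ :=
  Rank3Row.pSaturated_of_pSatCheckKSel_idx (by rfl) pSatCheckK_19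

/-- **GENERATORS under ONE named numeric hypothesis, chunk 19** (16 rows, register J11c
`m ≤ 10`; `m = 1` rows = LEVER S, saturation by exhaustive search): for every listed `(i, m)`, if
`rank3Rows19[i]` is a GRAND row and the index of its listed span is `≤ m` (instrument DATA, two
implementations agree), then `E(ℚ) = ℤP₁ + ℤP₂ + ℤP₃ + E(ℚ)_tors`.
[cite: CremonaPrickettSiksek2006, Thm 1] [cite: CremonaAlgorithms1997, §3.5] -/
theorem generators19 :
    ∀ e ∈ ([
      (21, 2), (27, 4), (28, 2), (61, 1), (68, 1), (82, 1), (86, 4), (138, 1), (160, 4), (178, 1),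
      (209, 2), (210, 2), (260, 1), (273, 1), (318, 1), (347, 1)] : List (ℕ × ℕ)),
      ∃ r, rank3Rows19[e.1]? = some r ∧ ∀ (hr : r ∈ rows) (h : r.check = true),
        (AddSubgroup.closure {r.gen₁ h, r.gen₂ h, r.gen₃ h} ⊔ AddCommGroup.torsion _).index ≤ e.2 →
          AddSubgroup.closure {r.gen₁ h, r.gen₂ h, r.gen₃ h} ⊔ AddCommGroup.torsion _ = ⊤ := by
  intro e he
  obtain ⟨r, hr', H⟩ := cover19 e he
  refine ⟨r, hr', fun hr h hB => ?_⟩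
  obtain ⟨hfi, h2, h3, h5, h7⟩ := PSatCensus357.index_coprime_210_of_mem_rows hr h
  haveI := hfi
  refine AddSubgroup.index_eq_one.mp
    (eq_one_of_forall_prime_le_not_dvd AddSubgroup.FiniteIndex.index_ne_zero hB fun p hp hpB => ?_)
  by_cases h7p : 7 < p
  · exact not_dvd_index_listedSpan hp (H p hp h7p hpB h)
  · exact not_dvd_of_prime_le_seven h2 h3 h5 h7 hp h7p

end PSatCensusS10CPS

end Summit.BirchSwinnertonDyer.BirchSwinnertonDyer.Rank2Observatory
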